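import Literature.AlgebraicGeometry.HodgeTheory.GlobalInvariantCyclesSectionsProofs
import Literature.AlgebraicGeometry.HodgeTheory.SmoothProjectiveCompactificationProofs
import Literature.AlgebraicGeometry.HodgeTheory.MonomialSupportedHypersurfaceFamilyPoints
import Literature.AlgebraicGeometry.HodgeTheory.HodgeGenericTypeStabilityOfGenericPoint
import Literature.AlgebraicGeometry.HodgeTheory.QbarFamilyLocalSystem
import Literature.AlgebraicGeometry.HodgeTheory.SupportedLocusClosed
import Literature.AlgebraicGeometry.HodgeTheory.AlgebraicMonodromyMumfordTate
import HarnessLib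

/-!
# Monodromy invariants of the monomial-supported family of hypersurfaces die where the fibres die

Family `hodge`, layer `Literature/AlgebraicGeometry/HodgeTheory`; theorems only (no definition, no
named fact). For a set `M` of degree-`d` monomials in `x₀, …, x_{n+1}` (`n, d ≥ 1`) let
`π_M = familyM ℂ n d M : 𝒴_M → S_M` be the family of smooth `M`-supported hypersurfaces
(`Motives/MonomialSupportedHypersurfaceFamily`), `Γ_t = ratMonodromyGroup π_M k _ t ⊆ GL(Hᵏ(Y_t; ℚ))`
its rational monodromy group at `t ∈ S_M(ℂ)` (`AlgebraicMonodromyMumfordTate`).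

**Main theorem** (`familyM_ratInvariant_eq_zero_of_factor`, Deligne's *théorème de la partie fixe*
in the form it is used for Lefschetz-type arguments, Voisin II Thm. 4.24 / Cor. 4.25 with the proof's
"let `X` be any smooth compactification"): ASSUME `deligne_globalInvariantCycles` (the tree's named
fact, Hodge II Thm. 4.1.1). If the total space `𝒴_M` admits an open immersion `j : 𝒴_M ⟶ W` over `ℂ`
into a smooth, quasi-projective, irreducible `W` such that every restriction
`Hᵏ(W(ℂ); ℂ) → Hᵏ(Y_t(ℂ); ℂ)` vanishes, then `Hᵏ(Y_t; ℚ)^{Γ_t} = 0` for every `t ∈ S_M(ℂ)`.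

Proof (§3): compactify `W ⊆ X̄` smooth projective (`Hironaka1964_smoothCompactification_holds`,
PROVED in `SmoothProjectiveCompactificationProofs`); a `Γ_t`-invariant rational class `x` has
complexification `x ⊗ 1` invariant under every transport `γ_*` (§2: the rational transport `T_γ`
exists, `exists_ratTransport`, and lies in `Γ_t`); `deligne_globalInvariantCycles.of_forall_transportFun_eq`
(base `S_M(ℂ)` path connected and locally path connected, §1) writes `x ⊗ 1 = (Y_t ↪ 𝒴_M ↪ W ↪ X̄)^* A`,
which factors through `Hᵏ(W) → Hᵏ(Y_t) = 0`; finally `Hᵏ(Y_t; ℚ) ↪ Hᵏ(Y_t; ℂ)` (`ofRatClass_injective`).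

* §1 `locallyPathConnectedSpace_complexPoints_baseM`, `connectedSpace_complexPoints_baseM`,
  `pathConnectedSpace_complexPoints_baseM` — `S_M(ℂ)` is a connected complex manifold (smooth,
  irreducible: `smooth_baseM_hom`, `irreducibleSpace_baseM_left`, SGA1 XII 2.4 via the tree's proved
  `ComplexPoints.isConnected_setOf_pt_mem_of_isIrreducible_holds`).
* §2 `isRationalClass_transportFun_familyM`, `transportFun_ofRatClass_eq_of_forall_mem_ratMonodromyGroup`.
* §3 `familyM_ratInvariant_eq_zero_of_factor`.

The intended `W` is the incidence variety `W_M ⊂ 𝔸^M × ℙⁿ⁺¹` of ALL `M`-supported forms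
(`Motives/MonomialLinearSystemIncidence`: smooth of relative dimension `|M| + n`, quasi-projective,
irreducible when `M` is base-point free), whose odd cohomology vanishes (it retracts onto the zero
section `ℙⁿ⁺¹(ℂ)`); that instance — "the monodromy of a base-point-free monomial linear system on the
middle cohomology of an odd-dimensional smooth member has no invariants" — is assembled in a sibling file.

## References

* P. Deligne, *Théorie de Hodge II*, Publ. Math. IHÉS 40 (1971), Thm. 4.1.1. [DeligneHodgeII1971]
* C. Voisin, *Hodge Theory and Complex Algebraic Geometry II* (2003), §3.1.2, Lemma 4.17,
  Thm. 4.24, Cor. 4.25. [VoisinHodgeII2003]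
* H. Hironaka, Resolution of singularities of an algebraic variety over a field of characteristic
  zero, Ann. of Math. 79 (1964), Main Theorem I. [Hironaka1964]
* J. Carlson, S. Müller-Stach, C. Peters, *Period Mappings and Period Domains*, 2nd ed. (2017),
  Lemma–Definition 15.3.7. [CarlsonMullerStachPeters2017]
* SGA1, Exp. XII Prop. 2.4. [SGA1]
-/

noncomputable section

open CategoryTheory AlgebraicGeometry
open _root_.Topology
open Literature.AlgebraicTopology.SingularHomology
open Literature.AlgebraicGeometry.Motives
open Literature.AlgebraicGeometry.Motives.UniversalHypersurface

universe u

namespace Literature.AlgebraicGeometry.HodgeTheory.UniversalHypersurface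

variable (n d : ℕ) (M : Set (DegIndex n d))

/-! ### §1 `S_M(ℂ)` is a connected, locally path-connected space -/

/-- `S_M → Spec ℂ` is locally of finite type (it is quasi-projective). [cite: Hartshorne1977, II §4 Definition (quasi-projective), p. 103] -/
theorem locallyOfFiniteType_baseM_hom : LocallyOfFiniteType (baseM ℂ n d M).hom :=
  (isQuasiProjectiveOver_baseM n d M).locallyOfFiniteType

/-- **`S_M(ℂ)` is locally path connected** (a complex manifold: `S_M` is smooth over `ℂ`,
`locallyPathConnectedSpace_complexPoints_of_smooth`). [cite: VoisinHodgeI2002, §9.1.1] -/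
theorem locallyPathConnectedSpace_complexPoints_baseM :
    LocallyPathConnectedSpace (ComplexPoints (baseM ℂ n d M)) :=
  haveI := smooth_baseM_hom ℂ n d M
  haveI := locallyOfFiniteType_baseM_hom n d M
  locallyPathConnectedSpace_complexPoints_of_smooth _

/-- **`S_M(ℂ)` is connected** as soon as it has a point: `S_M` is irreducible (open in the affine
space `𝔸^M`, `irreducibleSpace_baseM_left`) and the complex points of an irreducible complex variety
are connected (SGA1 XII Prop. 2.4, the tree's proved
`ComplexPoints.isConnected_setOf_pt_mem_of_isIrreducible_holds`). [cite: SGA1, Exp. XII Prop. 2.4] -/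
theorem connectedSpace_complexPoints_baseM (t : ComplexPoints (baseM ℂ n d M)) :
    ConnectedSpace (ComplexPoints (baseM ℂ n d M)) := by
  haveI := irreducibleSpace_baseM_left ℂ n d M ⟨t.pt⟩
  haveI := locallyOfFiniteType_baseM_hom n d M
  have h := Motives.ComplexPoints.isConnected_setOf_pt_mem_of_isIrreducible_holds (baseM ℂ n d M)
    isClosed_univ (IrreducibleSpace.isIrreducible_univ (X := ↥(baseM ℂ n d M).left))
  rw [connectedSpace_iff_univ]
  convert h using 1
  ext P
  simp

/-- **`S_M(ℂ)` is path connected** as soon as it has a point (connected and locally path connected).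
[cite: SGA1, Exp. XII Prop. 2.4] -/
theorem pathConnectedSpace_complexPoints_baseM (t : ComplexPoints (baseM ℂ n d M)) :
    PathConnectedSpace (ComplexPoints (baseM ℂ n d M)) := by
  haveI := smoothOfRelativeDimension_baseM_hom ℂ n d M
  haveI := locallyOfFiniteType_baseM_hom n d M
  haveI := connectedSpace_complexPoints_baseM n d M t
  exact pathConnectedSpace_complexPoints_of_smoothOfRelativeDimension _ (0 + Nat.card M)

/-! ### §2 Rational monodromy invariants are transport invariants -/

/-- **Transport in `Rᵏ π_{M*} ℂ` preserves rational classes** (the local system `Rᵏ π_{M*} ℚ`;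
Ehresmann over the smooth quasi-projective base `S_M`, `isRationalClass_transportFun_of_isSmoothProjectiveFamily`).
[cite: VoisinHodgeII2003, §3.1.2] -/
theorem isRationalClass_transportFun_familyM (hn : 1 ≤ n) (hd : 1 ≤ d) (k : ℕ)
    (hU : IsCohomologicallyLocallyTrivialOn (familyM ℂ n d M) Set.univ)
    {s t : (Set.univ : Set (ComplexPoints (baseM ℂ n d M)))} (γ : Path.Homotopic.Quotient s t)
    {α : complexBetti (fiberOver (familyM ℂ n d M) s.1) k} (hα : IsRationalClass α) :
    IsRationalClass (transportFun (familyM ℂ n d M) k hU γ α) :=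
  haveI := smoothOfRelativeDimension_baseM_hom ℂ n d M
  isRationalClass_transportFun_of_isSmoothProjectiveFamily (familyM ℂ n d M) k (0 + Nat.card M)
    (isSmoothProjectiveFamily_familyM ℂ n d M hn hd) (isQuasiProjectiveOver_baseM n d M) γ hα

/-- **A class fixed by the rational monodromy group has transport-invariant complexification**: for
`x ∈ Hᵏ(Y_t; ℚ)` with `g x = x` for all `g ∈ Γ_t` and a loop `γ` at `t`, the rational transport `T_γ`
(`exists_ratTransport`) lies in `Γ_t`, so `γ_* (x ⊗ 1) = (T_γ x) ⊗ 1 = x ⊗ 1`.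
[cite: CarlsonMullerStachPeters2017, Lemma–Definition 15.3.7] [cite: VoisinHodgeII2003, §3.1.2] -/
theorem transportFun_ofRatClass_eq_of_forall_mem_ratMonodromyGroup (hn : 1 ≤ n) (hd : 1 ≤ d) (k : ℕ)
    (hU : IsCohomologicallyLocallyTrivialOn (familyM ℂ n d M) Set.univ)
    (t : ComplexPoints (baseM ℂ n d M))
    (x : bettiCohomology (fiberOver (familyM ℂ n d M) t) k)
    (hx : ∀ g ∈ ratMonodromyGroup (familyM ℂ n d M) k hU ⟨t, Set.mem_univ t⟩, g x = x)
    (γ : Path.Homotopic.Quotient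
      (⟨t, Set.mem_univ t⟩ : (Set.univ : Set (ComplexPoints (baseM ℂ n d M)))) ⟨t, Set.mem_univ t⟩) :
    transportFun (familyM ℂ n d M) k hU γ (ofRatClass _ k x) = ofRatClass _ k x := by
  obtain ⟨T, hT⟩ := exists_ratTransport (familyM ℂ n d M) k hU
    (fun _ _ δ _ hα => isRationalClass_transportFun_familyM n d M hn hd k hU δ hα) γ
  rw [← hT x, hx T (mem_ratMonodromyGroup_of_isRatTransport (familyM ℂ n d M) k hU hT)]

/-! ### §3 Invariants vanish when the fibre inclusions factor through a cohomologically silent `W` -/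

/-- **Monodromy invariants of `π_M` die where the fibres die** (global invariant cycles + smooth
compactification). Assume `deligne_globalInvariantCycles`. Let `j : 𝒴_M ⟶ W` be an open immersion
over `ℂ` into a smooth (of some relative dimension `m`), quasi-projective, irreducible `W` such that
`(Y_t ↪ 𝒴_M ↪ W)^* : Hᵏ(W(ℂ); ℂ) → Hᵏ(Y_t(ℂ); ℂ)` vanishes for every `t ∈ S_M(ℂ)`. Then every class of
`Hᵏ(Y_t; ℚ)` fixed by the monodromy group `Γ_t` is zero. (Voisin II, proof of Thm. 4.24: "the space
of invariants is the image of `H^k(X, ℚ)` for ANY smooth projective `X ⊇ X_U`"; here `X = X̄ ⊇ W`,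
Hironaka.) [cite: VoisinHodgeII2003, Thm. 4.24 and Cor. 4.25] [cite: DeligneHodgeII1971, Théorème 4.1.1]
[cite: Hironaka1964, Main Theorem I] -/
theorem familyM_ratInvariant_eq_zero_of_factor (hGIC : deligne_globalInvariantCycles)
    (hn : 1 ≤ n) (hd : 1 ≤ d) (k : ℕ)
    (hU : IsCohomologicallyLocallyTrivialOn (familyM ℂ n d M) Set.univ)
    {W : SchemeOver ℂ} {m : ℕ} (hW : SmoothOfRelativeDimension m W.hom)
    (hWq : IsQuasiProjectiveOver W) (hWirr : IrreducibleSpace W.left)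
    (j : totalM ℂ n d M ⟶ W) (hj : IsOpenImmersion j.left)
    (hkill : ∀ (t : ComplexPoints (baseM ℂ n d M)) (β : complexBetti W k),
      complexBetti.map (fiberι (familyM ℂ n d M) t ≫ j) k β = 0)
    (t : ComplexPoints (baseM ℂ n d M))
    (x : bettiCohomology (fiberOver (familyM ℂ n d M) t) k)
    (hx : ∀ g ∈ ratMonodromyGroup (familyM ℂ n d M) k hU ⟨t, Set.mem_univ t⟩, g x = x) :
    x = 0 := by
  -- a smooth projective compactification of `W`
  obtain ⟨Xbar, iW, hXbar, hiW⟩ := Hironaka1964_smoothCompactification_holds m W hW hWq hWirr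
  haveI := hj
  haveI := hiW
  have hi : IsOpenImmersion (j ≫ iW).left := by
    rw [Over.comp_left]
    infer_instance
  haveI := pathConnectedSpace_complexPoints_baseM n d M t
  haveI := locallyPathConnectedSpace_complexPoints_baseM n d M
  -- the complexified class is a global (transport-invariant) section, hence comes from `X̄`
  obtain ⟨A, hA⟩ := hGIC.of_forall_transportFun_eq (familyM ℂ n d M) (j ≫ iW)
    (isSmoothProjectiveFamily_familyM ℂ n d M hn hd) (isQuasiProjectiveOver_baseM n d M)
    (smooth_baseM_hom ℂ n d M) hXbar.isProjectiveOver hXbar.smoothOfRelativeDimension hi hU k t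
    (ofRatClass _ k x)
    (transportFun_ofRatClass_eq_of_forall_mem_ratMonodromyGroup n d M hn hd k hU t x hx)
  -- and its restriction factors through `Hᵏ(W) → Hᵏ(Y_t) = 0`
  have hzero : ofRatClass _ k x = 0 := by
    rw [hA, ← Category.assoc, complexBetti.map_comp, ModuleCat.comp_apply]
    exact hkill t _
  exact ofRatClass_injective k (by rw [hzero, map_zero])

end Literature.AlgebraicGeometry.HodgeTheory.UniversalHypersurface

end
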